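import Mathlib.Analysis.Normed.Module.Basic
import Mathlib.Topology.EMetricSpace.Lipschitz
import Mathlib.Analysis.Normed.Module.RCLike.Real
import HarnessLib

/-!
# Radial (cone) extension of Lipschitz sphere maps is Lipschitz

For a real normed space `E` and a self-map `φ` of the unit sphere, the RADIAL EXTENSION
`radialExt φ x = ‖x‖ • φ (‖x‖⁻¹ • x)` (`0 ↦ 0`) satisfies: if `φ` is `L`-Lipschitz on the sphere and maps it into
itself, then `radialExt φ` is `(2L+1)`-Lipschitz on all of `E` (`lipschitzWith_radialExt`); and mutually inverse Lipschitz
sphere maps have mutually inverse Lipschitz radial extensions (`lipschitzWith_radialExt_and_leftInverse`).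

This is the elementary mechanism behind the LIP-standardness of TWISTED SPHERES `Dⁿ ∪_φ Dⁿ` in every dimension
(bib: KondoTanaka2017, Cor. 1.15 — every exotic 7-sphere is bi-Lipschitz homeomorphic to the standard sphere by a map smooth
off one point; the coning / Alexander extension of the clutching diffeomorphism is bi-Lipschitz although not smooth at the
cone point).  It is used as the BC5 "witness of weakness" of the crux `LipStandard` of route `LipschitzHauptvermutung`
(summit `SmoothPoincare4`): the Lipschitz category carries no clutching obstruction, in contrast with `Γₙ = Θₙ` smoothly.

Pure Mathlib analysis; no named facts, no hypotheses beyond the lemma statements.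
-/

open Metric Set
open scoped NNReal

namespace Literature.Geometry.Manifold

variable {E : Type*} [NormedAddCommGroup E] [NormedSpace ℝ E]

/-- Radial (cone) extension of a self-map of the unit sphere: `x ↦ ‖x‖ • φ (x / ‖x‖)` (and `0 ↦ 0`).
[cite: KondoTanaka2017, Corollary 1.15] -/
noncomputable def radialExt (φ : E → E) (x : E) : E :=
  ‖x‖ • φ (‖x‖⁻¹ • x)

/-- The radial extension fixes the origin. [folklore] -/
theorem radialExt_zero (φ : E → E) : radialExt φ 0 = 0 := by
  simp [radialExt]

/-- The key elementary estimate: `‖y‖ · ‖x/‖x‖ − y/‖y‖‖ ≤ 2 ‖x − y‖`. [folklore] -/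
theorem norm_mul_norm_sub_le (x y : E) (hx : x ≠ 0) (hy : y ≠ 0) :
    ‖y‖ * ‖‖x‖⁻¹ • x - ‖y‖⁻¹ • y‖ ≤ 2 * ‖x - y‖ := by
  have hxn : ‖x‖ ≠ 0 := norm_ne_zero_iff.mpr hx
  have hyn : ‖y‖ ≠ 0 := norm_ne_zero_iff.mpr hy
  have h1 : ‖y‖ • (‖x‖⁻¹ • x - ‖y‖⁻¹ • y) = (‖y‖ * ‖x‖⁻¹) • x - y := by
    rw [smul_sub, smul_smul, smul_smul, mul_inv_cancel₀ hyn, one_smul]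
  have h2 : (‖y‖ * ‖x‖⁻¹) • x - x = ((‖y‖ - ‖x‖) * ‖x‖⁻¹) • x := by
    rw [sub_mul, mul_inv_cancel₀ hxn, sub_smul, one_smul]
  have h3 : ‖(‖y‖ * ‖x‖⁻¹) • x - x‖ = |‖y‖ - ‖x‖| := by
    rw [h2, norm_smul, Real.norm_eq_abs, abs_mul, abs_inv, abs_norm, mul_assoc,
      inv_mul_cancel₀ hxn, mul_one]
  calc ‖y‖ * ‖‖x‖⁻¹ • x - ‖y‖⁻¹ • y‖
        = ‖‖y‖ • (‖x‖⁻¹ • x - ‖y‖⁻¹ • y)‖ := by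
          rw [norm_smul, Real.norm_of_nonneg (norm_nonneg _)]
    _ = ‖((‖y‖ * ‖x‖⁻¹) • x - x) + (x - y)‖ := by
          rw [h1]; congr 1; abel
    _ ≤ ‖(‖y‖ * ‖x‖⁻¹) • x - x‖ + ‖x - y‖ := norm_add_le _ _
    _ = |‖y‖ - ‖x‖| + ‖x - y‖ := by rw [h3]
    _ ≤ ‖x - y‖ + ‖x - y‖ := by
          gcongr
          rw [abs_sub_comm]
          exact abs_norm_sub_norm_le x y
    _ = 2 * ‖x - y‖ := by ring

/-- **The rung.**  If `φ` is `L`-Lipschitz on the unit sphere and maps it into itself, then its radial extension is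
`(2L+1)`-Lipschitz on the whole space. [cite: KondoTanaka2017, Corollary 1.15] -/
theorem lipschitzWith_radialExt {φ : E → E} {L : ℝ≥0}
    (hφ : LipschitzOnWith L φ (sphere (0 : E) 1)) (hmaps : MapsTo φ (sphere (0 : E) 1) (sphere (0 : E) 1)) :
    LipschitzWith (2 * L + 1) (radialExt φ) := by
  have hL : (0 : ℝ) ≤ L := L.coe_nonneg
  have key0 : ∀ x : E, ‖radialExt φ x‖ = ‖x‖ := by
    intro x
    rcases eq_or_ne x 0 with rfl | hx
    · simp [radialExt]
    · have hm := hmaps ((show ‖x‖⁻¹ • x ∈ sphere (0 : E) 1 by rw [mem_sphere_zero_iff_norm, norm_smul, norm_inv, norm_norm, inv_mul_cancel₀ (norm_ne_zero_iff.mpr hx)]))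
      rw [mem_sphere_zero_iff_norm] at hm
      rw [radialExt, norm_smul, Real.norm_of_nonneg (norm_nonneg _), hm, mul_one]
  refine LipschitzWith.of_dist_le_mul fun x y => ?_
  have hcoe : ((2 * L + 1 : ℝ≥0) : ℝ) = 2 * (L : ℝ) + 1 := by push_cast; ring
  rw [hcoe, dist_eq_norm, dist_eq_norm]
  rcases eq_or_ne x 0 with rfl | hx
  · rw [radialExt_zero, zero_sub, norm_neg, key0, zero_sub, norm_neg]
    nlinarith [norm_nonneg y]
  rcases eq_or_ne y 0 with rfl | hy
  · rw [radialExt_zero, sub_zero, key0, sub_zero]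
    nlinarith [norm_nonneg x]
  -- both non-zero
  have hxs := (show ‖x‖⁻¹ • x ∈ sphere (0 : E) 1 by rw [mem_sphere_zero_iff_norm, norm_smul, norm_inv, norm_norm, inv_mul_cancel₀ (norm_ne_zero_iff.mpr hx)])
  have hys := (show ‖y‖⁻¹ • y ∈ sphere (0 : E) 1 by rw [mem_sphere_zero_iff_norm, norm_smul, norm_inv, norm_norm, inv_mul_cancel₀ (norm_ne_zero_iff.mpr hy)])
  have hφx : ‖φ (‖x‖⁻¹ • x)‖ = 1 := by
    have := hmaps hxs; rwa [mem_sphere_zero_iff_norm] at this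
  have hlip : ‖φ (‖x‖⁻¹ • x) - φ (‖y‖⁻¹ • y)‖ ≤ L * ‖‖x‖⁻¹ • x - ‖y‖⁻¹ • y‖ := by
    have := hφ.dist_le_mul _ hxs _ hys
    rwa [dist_eq_norm, dist_eq_norm] at this
  have hdecomp : radialExt φ x - radialExt φ y
      = (‖x‖ - ‖y‖) • φ (‖x‖⁻¹ • x) + ‖y‖ • (φ (‖x‖⁻¹ • x) - φ (‖y‖⁻¹ • y)) := by
    simp only [radialExt, sub_smul, smul_sub]; abel
  have hkey := norm_mul_norm_sub_le x y hx hy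
  calc ‖radialExt φ x - radialExt φ y‖
        = ‖(‖x‖ - ‖y‖) • φ (‖x‖⁻¹ • x) + ‖y‖ • (φ (‖x‖⁻¹ • x) - φ (‖y‖⁻¹ • y))‖ := by rw [hdecomp]
    _ ≤ ‖(‖x‖ - ‖y‖) • φ (‖x‖⁻¹ • x)‖ + ‖‖y‖ • (φ (‖x‖⁻¹ • x) - φ (‖y‖⁻¹ • y))‖ := norm_add_le _ _
    _ = |‖x‖ - ‖y‖| + ‖y‖ * ‖φ (‖x‖⁻¹ • x) - φ (‖y‖⁻¹ • y)‖ := by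
          rw [norm_smul, Real.norm_eq_abs, hφx, mul_one, norm_smul, Real.norm_of_nonneg (norm_nonneg _)]
    _ ≤ ‖x - y‖ + ‖y‖ * (L * ‖‖x‖⁻¹ • x - ‖y‖⁻¹ • y‖) := by
          gcongr
          exact abs_norm_sub_norm_le x y
    _ = ‖x - y‖ + L * (‖y‖ * ‖‖x‖⁻¹ • x - ‖y‖⁻¹ • y‖) := by ring
    _ ≤ ‖x - y‖ + L * (2 * ‖x - y‖) := by gcongr
    _ = (2 * L + 1) * ‖x - y‖ := by ring

/-- **Coning of a bi-Lipschitz clutching map** — the coning homeomorphism of a bi-Lipschitz clutching map is bi-Lipschitz: for a pair of mutually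
inverse Lipschitz self-maps `φ, ψ` of the unit sphere, the radial extensions are Lipschitz and mutually inverse on the whole space.
(This is the LIP-standardness of every twisted sphere `Dⁿ ∪_φ Dⁿ`, n arbitrary — in particular of all 28 smooth 7-spheres — i.e. the
sibling-setting analogue of K1 that holds where the analogue of SPC4 fails.) [cite: KondoTanaka2017, Corollary 1.15] -/
theorem lipschitzWith_radialExt_and_leftInverse {φ ψ : E → E} {L : ℝ≥0}
    (hφ : LipschitzOnWith L φ (sphere (0 : E) 1)) (hφm : MapsTo φ (sphere (0 : E) 1) (sphere (0 : E) 1))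
    (hψ : LipschitzOnWith L ψ (sphere (0 : E) 1)) (hψm : MapsTo ψ (sphere (0 : E) 1) (sphere (0 : E) 1))
    (hinv : ∀ u ∈ sphere (0 : E) 1, ψ (φ u) = u) :
    LipschitzWith (2 * L + 1) (radialExt φ) ∧ LipschitzWith (2 * L + 1) (radialExt ψ) ∧
      ∀ x : E, radialExt ψ (radialExt φ x) = x := by
  refine ⟨lipschitzWith_radialExt hφ hφm, lipschitzWith_radialExt hψ hψm, fun x => ?_⟩
  rcases eq_or_ne x 0 with rfl | hx
  · simp [radialExt]
  have hxs := (show ‖x‖⁻¹ • x ∈ sphere (0 : E) 1 by rw [mem_sphere_zero_iff_norm, norm_smul, norm_inv, norm_norm, inv_mul_cancel₀ (norm_ne_zero_iff.mpr hx)])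
  have hφx : ‖φ (‖x‖⁻¹ • x)‖ = 1 := by
    have := hφm hxs; rwa [mem_sphere_zero_iff_norm] at this
  have hxn : ‖x‖ ≠ 0 := norm_ne_zero_iff.mpr hx
  have hn : ‖‖x‖ • φ (‖x‖⁻¹ • x)‖ = ‖x‖ := by
    rw [norm_smul, Real.norm_of_nonneg (norm_nonneg _), hφx, mul_one]
  simp only [radialExt]
  rw [hn, smul_smul, inv_mul_cancel₀ hxn, one_smul, hinv _ hxs, smul_smul, mul_inv_cancel₀ hxn, one_smul]

end Literature.Geometry.Manifold
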